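import Literature.Barriers.CriticalPhenomena.RigorousRGSmallParameterFRDProfile
import HarnessLib

/-!
# `RigorousRGSmallParameter` (Slade, Theorem 1.4.1): the terms `Γ_j(s)` of the finite-range
# decomposition of `(-Δ_{ℤ^d}+s)⁻¹` ([Baue13a] as in BBS Ch. 3) — definitions, the `k`-space
# identity `1/(λ(k)+s) = ∫₀^∞ ŵ(t,k)dt/t`, positivity of `ŵ`, and the finite-range property (3.1)

Companion of `RigorousRGSmallParameterFRDProfile.lean` (the concrete admissible profile `f` and
the unconditional finite propagation of `w(t,x)`) in the proof architecture of the barrier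
`RigorousRGSmallParameter.lean`. Sources: R. Bauerschmidt, D. Brydges, G. Slade, *Introduction to
a renormalisation group method* (LNM 2242, 2019; arXiv:1907.05474), Ch. 3, section "Finite-range
decomposition: lattice", subsection "Integral decomposition": "let `M² = 2d+m²` and set
`ζ = (λ(k)+m²)/M²` … `1/(λ(k)+m²) = ∫₀^∞ ŵ(t,k) dt/t` with `ŵ(t,k) = (t²/M²)P_t(M⁻²(λ(k)+m²))`",
"`w(t,x) = (2π)^{-d}∫_{[-π,π]^d} ŵ(t,k)e^{ik·x}dk`", "`C_{1;0x} = ∫₀^{½L} w(t,x)dt/t`,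
`C_{j;0x} = ∫_{½L^{j-1}}^{½L^j} w(t,x)dt/t` (`j ≥ 2`)", "the inequality `P_t(ζ) ≥ 0` implies that
this decomposition is positive semi-definite", "`w(t,x) = 0` if `|x|₁ > t` … this gives the
finite-range property"; and G. Slade, CMP 358 (2018), §3.1: "`Γ = (-Δ_{ℤ^d}+s)⁻¹ = Σ_j Γ_j`
obtained in [Baue13a] … Each `Γ_j` is a positive semi-definite `ℤ^d × ℤ^d` matrix, has the
finite-range property (3.1) `Γ_{j;x,y} = 0` if `|x-y| ≥ ½L^j`". Here BBS's mass `m²` is Slade's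
`s > 0` (the decomposition is applied to `(-Δ+s)⁻¹` inside the Kato mixture (3.6)).

## What this file provides

* `FRD.cProfile` (`c = ∫₀^∞uf(u)du > 0`, the normalisation: the book takes `c = 1`),
  `FRD.wHat d s t k` (`ŵ(t,k)`, for the normalised profile `f/c`), `FRD.wKer d s t x` (`w(t,x)`),
  `FRD.scaleLower`, `FRD.Gam d L s j x` (`Γ_j(s)` as a translation-invariant kernel
  `Γ_{j;x,y} = Γ_j(x-y)`; `j ≥ 1`) — definitions with bodies.
* `FRD.periodicProfile_nonneg`, `FRD.chebyProfile_nonneg`, `FRD.wHat_nonneg` — positivity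
  (`f ≥ 0 ⇒ f*_t ≥ 0 ⇒ P_t ≥ 0 ⇒ ŵ ≥ 0`).
* **`FRD.integral_wHat_div`** — display (3.17) PROVED: `∫₀^∞ ŵ(t,k)dt/t = 1/(λ(k)+s)` for `s > 0`
  and all `k` (`FRD.spectralArg_mem`: `ζ = (λ(k)+s)/(2d+s) ∈ (0,4)`).
* **`FRD.wKer_eq_zero`**, **`FRD.Gam_eq_zero`** — the finite-range property, PROVED:
  `w(t,x) = 0` for `⌊t⌋ < |x|₁`, hence `Γ_j(x) = 0` for `|x|₁ ≥ ½L^j` (Slade (3.1), `ℓ¹` form as in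
  BBS; the Euclidean form follows since `|x|₂ ≤ |x|₁`).
* `FRD.wKer_neg`, `FRD.Gam_neg` — symmetry of the kernels.

No named fact is introduced. Not treated here (next file): the `x`-space identity
`Σ_j Γ_j(x) = (-Δ+s)⁻¹_{0,x}` (Fubini over `(0,∞) × [-π,π]^d` with (3.17) and
`resolventZd_eq_integral`), positive semi-definiteness of each `Γ_j`, and the estimates of
Proposition 3.3.1 / BBS Proposition "Covariance decomposition".
-/

noncomputable section

namespace Literature.Barriers.CriticalPhenomena

open _root_.MeasureTheory Set Filter
open scoped _root_.Topology Real

namespace LongRangePhi4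

namespace FRD

open Literature.Probability.LatticeModels

variable {d : ℕ}

/-! ### The normalisation constant and the positivity of `P_t` -/

/-- The normalisation constant `c = ∫₀^∞ u f(u) du` of the concrete profile `f = Re F` (the book
normalises `f` so that `c = 1`, its (eq:1/lambda-decomp)). [cite: BauerschmidtBrydgesSlade2019RG, Ch. 3, "Finite-range decomposition: continuum" (normalisation of f)] -/
def cProfile : ℝ := ∫ u in Ioi (0 : ℝ), u * (profile u).re

/-- `c > 0`. [folklore] -/
theorem cProfile_pos : 0 < cProfile := integral_mul_profile_re_pos

/-- `f*_t(x) ≥ 0` for a nonnegative profile ("`f*_t ≥ 0` since `f ≥ 0`").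
[cite: BauerschmidtBrydgesSlade2019RG, Ch. 3, "Finite-range decomposition: lattice" (f*_t ≥ 0)] -/
theorem periodicProfile_nonneg {f : ℝ → ℝ} (hf : ∀ u, 0 ≤ f u) (t x : ℝ) :
    0 ≤ periodicProfile f t x := by
  unfold periodicProfile
  exact tsum_nonneg fun n => hf _

/-- `P_t(ζ) ≥ 0` for a nonnegative profile ("Since `f*_t ≥ 0`, also `P_t(ζ) ≥ 0`").
[cite: BauerschmidtBrydgesSlade2019RG, Ch. 3, "Finite-range decomposition: lattice" (P_t ≥ 0)] -/
theorem chebyProfile_nonneg {f : ℝ → ℝ} (hf : ∀ u, 0 ≤ f u) (t ζ : ℝ) :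
    0 ≤ chebyProfile f t ζ :=
  periodicProfile_nonneg hf t _

/-! ### `ŵ(t,k)`, `w(t,x)` and `Γ_j` -/

/-- **`ŵ(t,k) = (t²/M²) P_t(M⁻²(λ(k)+s))`** with `M² = 2d + s` (BBS, the display defining `ŵ`),
for the normalised profile `f/c`. [cite: BauerschmidtBrydgesSlade2019RG, Ch. 3, "Finite-range decomposition: lattice" (definition of ŵ(t,k))] -/
def wHat (d : ℕ) (s t : ℝ) (k : Fin d → ℝ) : ℝ :=
  t ^ 2 / (cProfile * (2 * d + s)) *
    chebyProfile (fun v => (profile v).re) t ((laplaceSymbol k + s) / (2 * d + s))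

/-- **`w(t,x) = (2π)^{-d}∫_{[-π,π]^d} ŵ(t,k)e^{ik·x}dk`** (BBS, the display defining `w(t,x)`; real
`cos` form, `ŵ(t,·)` being even). [cite: BauerschmidtBrydgesSlade2019RG, Ch. 3, "Finite-range decomposition: lattice" (definition of w(t,x))] -/
def wKer (d : ℕ) (s t : ℝ) (x : Site d) : ℝ :=
  ((2 * π) ^ d : ℝ)⁻¹ * ∫ k in brillouin d, wHat d s t k * Real.cos (phase k x)

/-- The lower end of the `j`-th scale interval: `0` for `j ≤ 1`, `½L^{j-1}` for `j ≥ 2`.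
[cite: BauerschmidtBrydgesSlade2019RG, Ch. 3, "Finite-range decomposition: lattice" (the intervals [0,L/2] and [L^{j-1}/2, L^j/2])] -/
def scaleLower (L : ℝ) (j : ℕ) : ℝ := if j ≤ 1 then 0 else L ^ (j - 1) / 2

/-- **The terms of the decomposition**: `Γ_1(x) = ∫_0^{L/2} w(t,x)dt/t`,
`Γ_j(x) = ∫_{L^{j-1}/2}^{L^j/2} w(t,x)dt/t` (`j ≥ 2`) — BBS's `C_j` (there for `s = m²`), Slade's
`Γ_j(s)` of (3.1)–(3.3) — as translation-invariant kernels `Γ_{j;x,y} = Γ_j(x-y)` on `ℤ^d`.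
[cite: BauerschmidtBrydgesSlade2019RG, Ch. 3, "Finite-range decomposition: lattice" (definition of C_1 and C_j)] [cite: Slade2017, §3.1 (display (3.1))] -/
def Gam (d : ℕ) (L s : ℝ) (j : ℕ) (x : Site d) : ℝ :=
  ∫ t in Ioc (scaleLower L j) (L ^ j / 2), wKer d s t x / t

/-! ### Positivity of `ŵ` and the `k`-space identity (3.17) -/

/-- `ŵ(t,k) ≥ 0` (`P_t ≥ 0`, `s ≥ 0`). [cite: BauerschmidtBrydgesSlade2019RG, Ch. 3, "Finite-range decomposition: lattice" ("the inequality P_t(ζ) ≥ 0 implies that this decomposition is positive semi-definite")] -/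
theorem wHat_nonneg {s : ℝ} (hs : 0 ≤ s) (t : ℝ) (k : Fin d → ℝ) : 0 ≤ wHat d s t k := by
  unfold wHat
  refine mul_nonneg (div_nonneg (sq_nonneg _)
    (mul_nonneg cProfile_pos.le (by positivity))) ?_
  exact chebyProfile_nonneg profile_re_nonneg _ _

/-- The spectral argument `ζ = (λ(k)+s)/(2d+s)` lies in `(0,4)` for `s > 0` ("let `M² = 2d+m²` and
set `ζ = (λ(k)+m²)/M²`; then `ζ ∈ (0,2]`"). [cite: BauerschmidtBrydgesSlade2019RG, Ch. 3, "Finite-range decomposition: lattice" (the choice M² = 2d + m²)] -/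
theorem spectralArg_mem {s : ℝ} (hs : 0 < s) (k : Fin d → ℝ) :
    0 < (laplaceSymbol k + s) / (2 * d + s) ∧ (laplaceSymbol k + s) / (2 * d + s) < 4 := by
  have hM : 0 < 2 * (d : ℝ) + s := by positivity
  refine ⟨div_pos (add_pos_of_nonneg_of_pos (laplaceSymbol_nonneg k) hs) hM, ?_⟩
  rw [div_lt_iff₀ hM]
  have := laplaceSymbol_le k
  nlinarith

/-- **BBS, display (3.17), PROVED: `1/(λ(k)+s) = ∫₀^∞ ŵ(t,k) dt/t`** for `s > 0` and every `k`
(the integral decomposition of `1/ζ` at `ζ = (λ(k)+s)/M²`, rescaled by `t²/M²`).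
[cite: BauerschmidtBrydgesSlade2019RG, Ch. 3, "Finite-range decomposition: lattice" (display 1/(λ(k)+m²) = ∫₀^∞ ŵ(t,k) dt/t)] -/
theorem integral_wHat_div {s : ℝ} (hs : 0 < s) (k : Fin d → ℝ) :
    ∫ t in Ioi (0 : ℝ), wHat d s t k / t = 1 / (laplaceSymbol k + s) := by
  have hM : 0 < 2 * (d : ℝ) + s := by positivity
  have hc := cProfile_pos
  obtain ⟨hζ0, hζ4⟩ := spectralArg_mem hs k
  set ζ : ℝ := (laplaceSymbol k + s) / (2 * d + s) with hζ
  have hmain := integral_mul_chebyProfile_profile hζ0 hζ4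
  -- `ŵ/t = (cM²)⁻¹ · t P_t(ζ)` on `(0,∞)`
  have hpt : ∀ t ∈ Ioi (0 : ℝ), wHat d s t k / t =
      (cProfile * (2 * d + s))⁻¹ * (t * chebyProfile (fun v => (profile v).re) t ζ) := by
    intro t ht
    unfold wHat
    have ht' : (t : ℝ) ≠ 0 := (ne_of_gt ht)
    field_simp
    rw [hζ]
  rw [setIntegral_congr_fun measurableSet_Ioi hpt, integral_const_mul, hmain]
  change (cProfile * (2 * d + s))⁻¹ * (cProfile / ζ) = 1 / (laplaceSymbol k + s)
  rw [hζ]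
  have hls : laplaceSymbol k + s ≠ 0 := (add_pos_of_nonneg_of_pos (laplaceSymbol_nonneg k) hs).ne'
  field_simp

/-! ### The finite-range property -/

/-- **`w(t,x) = 0` if `|x|₁ > t`** (for `d ≥ 1`, `t > 0`, `s ≥ 0`; here in the form `⌊t⌋ < |x|₁`).
[cite: BauerschmidtBrydgesSlade2019RG, Ch. 3, "Finite-range decomposition: lattice" (w(t,x) = 0 if |x|₁ > t)] -/
theorem wKer_eq_zero (hd : 1 ≤ d) {s : ℝ} (hs : 0 ≤ s) {t : ℝ} (ht : 0 < t) (x : Site d)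
    (hx : ⌊t⌋₊ < ∑ i, (x i).natAbs) : wKer d s t x = 0 := by
  unfold wKer
  have h := setIntegral_chebyProfile_profile_mul_cos_eq_zero hd ht hs x hx
  have e : (fun k : Fin d → ℝ => wHat d s t k * Real.cos (phase k x)) =
      fun k => t ^ 2 / (cProfile * (2 * d + s)) *
        (chebyProfile (fun v => (profile v).re) t ((laplaceSymbol k + s) / (2 * d + s)) *
          Real.cos (phase k x)) := by
    funext k
    unfold wHat
    ring
  rw [e, integral_const_mul, h, mul_zero, mul_zero]

/-- **Slade, display (3.1) / BBS finite-range property, PROVED: `Γ_{j;x,y} = 0` if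
`|x-y|₁ ≥ ½L^j`** (`d ≥ 1`, `s ≥ 0`, `L ≥ 0`, any `j`): on the `j`-th scale interval
`t ≤ ½L^j ≤ |x|₁`, so `w(t,x) = 0` for every `t < |x|₁`, i.e. for a.e. `t` in the interval.
[cite: Slade2017, §3.1 (display (3.1))] [cite: BauerschmidtBrydgesSlade2019RG, Ch. 3, "Finite-range decomposition: lattice" (finite-range property of C_j)] -/
theorem Gam_eq_zero (hd : 1 ≤ d) {L : ℝ} (hL : 0 ≤ L) {s : ℝ} (hs : 0 ≤ s) (j : ℕ) (x : Site d)
    (hx : L ^ j / 2 ≤ ((∑ i, (x i).natAbs : ℕ) : ℝ)) : Gam d L s j x = 0 := by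
  unfold Gam
  rw [integral_Ioc_eq_integral_Ioo]
  have hlo : 0 ≤ scaleLower L j := by
    unfold scaleLower
    split_ifs
    · exact le_refl _
    · positivity
  refine (setIntegral_congr_fun measurableSet_Ioo (g := fun _ => (0 : ℝ)) fun t ht => ?_).trans
    (by simp)
  have ht0 : 0 < t := lt_of_le_of_lt hlo ht.1
  have hfl : ⌊t⌋₊ < ∑ i, (x i).natAbs := by
    have h1 : (⌊t⌋₊ : ℝ) ≤ t := Nat.floor_le ht0.le
    have h2 : t < ((∑ i, (x i).natAbs : ℕ) : ℝ) := lt_of_lt_of_le ht.2 hx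
    exact_mod_cast lt_of_le_of_lt h1 h2
  show wKer d s t x / t = 0
  rw [wKer_eq_zero hd hs ht0 x hfl, zero_div]

/-! ### Symmetry -/

/-- `w(t,-x) = w(t,x)`. [folklore] -/
theorem wKer_neg (s t : ℝ) (x : Site d) : wKer d s t (-x) = wKer d s t x := by
  unfold wKer
  congr 1
  refine integral_congr_ae (Eventually.of_forall fun k => ?_)
  have hneg : phase k (-x) = -phase k x := by
    unfold phase
    rw [← Finset.sum_neg_distrib]
    refine Finset.sum_congr rfl fun j _ => ?_
    rw [Pi.neg_apply, Int.cast_neg]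
    ring
  simp only [hneg, Real.cos_neg]

/-- `Γ_j(-x) = Γ_j(x)` (the kernels `Γ_{j;x,y} = Γ_j(x-y)` are symmetric).
[cite: Slade2017, §3.1 ("Each Γ_j is a positive semi-definite ℤ^d × ℤ^d matrix")] -/
theorem Gam_neg (L s : ℝ) (j : ℕ) (x : Site d) : Gam d L s j (-x) = Gam d L s j x := by
  unfold Gam
  simp_rw [wKer_neg]

end FRD

end LongRangePhi4

end Literature.Barriers.CriticalPhenomena
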